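import Literature.AlgebraicGeometry.Limits.RationalFunctions
import Literature.AlgebraicGeometry.Limits.CartierDivisorLinEquiv
import Literature.AlgebraicGeometry.Motives.CartierDivisorAmpleOfSmul
import Literature.AlgebraicGeometry.Motives.CartierDivisorClassPullback
import HarnessLib

/-!
# Ampleness spreads out: an ample divisor on `P ×_K Spec Ω` is already ample over a finitely
# generated subalgebra `K[t] ⊆ Ω`, hence over every intermediate field containing `t`

Layer `Literature/AlgebraicGeometry/Motives` (cell `hodgecm-mathlib`, (L3) road, file F2; generic and
Mathlib-grade: nothing about abelian varieties is used).  Let `K` be a field, `B` a `K`-algebra which is a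
domain and `P → Spec K` quasi-compact, quasi-separated and geometrically integral.  The tree presents
`(P ⊗ Spec B).left = P ×_K Spec B` as the limit of the cofiltered diagram of the
`(P ⊗ Spec K[t]).left = P ×_K Spec K[t]` over the finitely generated `K`-subalgebras `K[t] ⊆ B`
(`Limits/SubalgebraDiagram`: `SubalgApprox.prodDiagram`, `prodCone`, `isLimitProdCone`; Görtz–Wedhorn I,
(10.13)), with affine dominant legs `π_t` and transition maps, and proves that rational functions, regular
functions, units and coverings descend along it (`Limits/RatFnLimitDescent`, `Limits/RationalFunctions`;
Görtz–Wedhorn I, Thm. 10.57).  Mathlib's `AffineTransitionLimit` proves that affine opens of the limit are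
preimages of affine opens of a stage (`exists_isAffineOpen_preimage_eq`,
`Scheme.exists_isOpenCover_and_isAffine_of_finite`, The Stacks Project, Tags 01Z4, 01Z6) and that two
quasi-compact opens of a stage with the same preimage in the limit agree at a finer stage
(`exists_map_preimage_eq_map_preimage`, Tag 01Z4 (2)).

In the tree's currency an ample Cartier divisor is the record of Görtz–Wedhorn I, Prop. 13.47 (iv)
(`CartierDivisor.IsAmple`, `Motives/CartierDivisor`): `X` qcqs and some `d ≥ 1` such that every point lies
in an AFFINE non-vanishing locus `X_s` of a section `s ∈ Γ(X, 𝒪_X(d • D))`.  This file proves that this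
property SPREADS OUT from the limit to a finite stage:

* `CartierDivisor.IsAmple.exists_hom_isAmple_pullback_map` — **if a Cartier divisor `E` on a stage
  `P ×_K Spec K[t₀]` becomes ample on the limit `P ×_K Spec B`, then it is ample on some finer stage
  `P ×_K Spec K[t]`**: finitely many affine `X_{s_l}` cover the quasi-compact limit; the rational functions
  `s_l` descend to a stage (`SubalgApprox.exists_functionFieldMap_eq`), their section property descends
  chart by chart (finitely many affine charts, `CartierDivisor.exists_sameDivisor_finite_isAffineOpen`;
  `Limits.exists_forall_isRegularAt_functionFieldMap`), the affine cover `X_{s_l}` is the preimage of an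
  affine open cover `V_l` of a stage (Mathlib `Scheme.exists_isOpenCover_and_isAffine_of_finite`), and at a
  finer stage the non-vanishing loci of the descended sections ARE the (affine) preimages of the `V_l`
  (`exists_map_preimage_eq_map_preimage`, both being quasi-compact: `CartierDivisor.isCompact_nonvanishing`);
* `CartierDivisor.IsAmple.exists_finset_forall_isAmple_classPullback` (and `…_pullback`) — **the tower
  form consumed by the (L3) assembly**: for a field extension `Ω/K` and `D` on `P` with `D ⊗ Ω` ample there
  is a finite `s' ⊆ Ω` such that `D ⊗ L` is ample for EVERY intermediate extension `K → L → Ω` whose image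
  contains `s'` (base change `P ×_K Spec L → P ×_K Spec K[s']` along `K[s'] ↪ L`, an affine dominant
  morphism, and `CartierDivisor.IsAmple.pullback`).

Also recorded (B-typ02's groundwork): sections and non-vanishing loci are invariant under `SameDivisor`
(`CartierDivisor.SameDivisor.isSection`, `….nonvanishing_eq`), `X_s` is quasi-compact for a divisor with
finitely many affine charts (`CartierDivisor.isCompact_nonvanishing`).  No H⁰ base change, no algebraic
closedness and no fpqc descent is used.  All statements PROVED; no definition, no named fact, no
instance, no `sorry`.

Mathlib searched (pin): `AffineTransitionLimit` (`Scheme.exists_isOpenCover_and_isAffine_of_finite`,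
`exists_map_preimage_eq_map_preimage`, `exists_map_eq_top`), `CompactSpace.elim_nhds_subcover`,
`IsAffineOpen.preimage`, `QuasiCompact.isCompact_preimage`, `Over.whiskerLeft_left_fst`,
`PrimeSpectrum.denseRange_comap_iff_ker_le_nilRadical`, `AlgEquiv.ofInjective`, `Algebra.adjoin_le` (used);
Mathlib has no ample line bundles on general schemes and no descent of ampleness along limits.

## References
* [GortzWedhorn2020] U. Görtz, T. Wedhorn, *Algebraic Geometry I: Schemes*, 2nd ed. (2020): (10.13) and
  Thm. 10.57 (p. 264; descent of sections, opens and coverings along limits with affine transition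
  maps), (11.9) (p. 301; `Γ(X, 𝒪_X(D))`), Def. 13.44 and Prop. 13.47 (iv) (p. 392; ample line bundles via
  affine `X_f`), Prop. 13.66 (2) (p. 402; pullback along affine morphisms); page digits are those of the held
  e-text.
* [StacksProject] The Stacks Project, Tag 01Z4 (1), (2) and Tag 01Z6 (Limits of schemes: opens and
  affineness descend) — through Mathlib's `AffineTransitionLimit`.
-/

set_option autoImplicit false

noncomputable section

universe u

open CategoryTheory CategoryTheory.Limits AlgebraicGeometry MonoidalCategory TopologicalSpace
open Opposite
open Literature.AlgebraicGeometry.Limits Literature.AlgebraicGeometry.Limits.SubalgApprox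
open Literature.AlgebraicGeometry.Motives.RatFn

namespace Literature.AlgebraicGeometry.Motives

/-! ### Sections and non-vanishing loci along `SameDivisor`; quasi-compactness of `X_s` -/

namespace CartierDivisor

variable {X : Scheme.{u}} [IsIntegral X] {D E : CartierDivisor X}

/-- A global section of `𝒪_X(D)` is a global section of `𝒪_X(E)` when `D` and `E` are the same divisor
(`f'_j s = (f'_j / f_i) (f_i s)` with `f'_j / f_i` a unit on `U_i ∩ U'_j`: Görtz–Wedhorn I, Def. 11.20 —
presentations with `f_i g_j⁻¹ ∈ Γ(U_i ∩ V_j, 𝒪_X^×)` give the same divisor — and (11.9), `Γ(X, 𝒪_X(D))`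
depends only on the divisor). [cite: GortzWedhorn2020, Def. 11.20 (p. 301) with Section (11.9) (p. 301)] -/
theorem SameDivisor.isSection (H : D.SameDivisor E) {s : X.functionField} (hs : D.IsSection s) :
    E.IsSection s := fun j x hj => by
  obtain ⟨i, hi⟩ := D.covers x
  have hu : IsUnitAt x (E.f j / D.f i) := H.symm j i x hj hi
  have heq : E.f j * s = E.f j / D.f i * (D.f i * s) := by
    field_simp [D.f_ne_zero i]
  rw [heq]
  exact hu.isRegularAt.mul (hs i x hi)

/-- `SameDivisor` preserves the property of being a section (both directions; Görtz–Wedhorn I,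
Def. 11.20 with (11.9)). [cite: GortzWedhorn2020, Def. 11.20 (p. 301) with Section (11.9) (p. 301)] -/
theorem SameDivisor.isSection_iff (H : D.SameDivisor E) {s : X.functionField} :
    D.IsSection s ↔ E.IsSection s :=
  ⟨H.isSection, H.symm.isSection⟩

/-- The non-vanishing locus `X_s` does not depend on the presentation of the divisor (Görtz–Wedhorn I,
Def. 11.20: same divisor, same line bundle `𝒪_X(D)` and hence same `X_s`, Remark 13.46).
[cite: GortzWedhorn2020, Def. 11.20 (p. 301) with Remark 13.46 (p. 391)] -/
theorem SameDivisor.nonvanishing_eq (H : D.SameDivisor E) (s : X.functionField) :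
    D.nonvanishing s = E.nonvanishing s := by
  ext x
  obtain ⟨i, hi⟩ := D.covers x
  obtain ⟨j, hj⟩ := E.covers x
  rw [D.mem_nonvanishing_iff hi, E.mem_nonvanishing_iff hj]
  have hu : IsUnitAt x (E.f j / D.f i) := H.symm j i x hj hi
  have heq : E.f j * s = E.f j / D.f i * (D.f i * s) := by
    field_simp [D.f_ne_zero i]
  have heq' : D.f i * s = (E.f j / D.f i)⁻¹ * (E.f j * s) := by
    field_simp [D.f_ne_zero i, E.f_ne_zero j]
  exact ⟨fun h => heq ▸ hu.mul h, fun h => heq' ▸ hu.inv.mul h⟩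

/-- The same for the open subschemes `X_s` (Görtz–Wedhorn I, Def. 11.20 with Remark 13.46).
[cite: GortzWedhorn2020, Def. 11.20 (p. 301) with Remark 13.46 (p. 391)] -/
theorem SameDivisor.nonvanishingOpens_eq (H : D.SameDivisor E) (s : X.functionField) :
    D.nonvanishingOpens s = E.nonvanishingOpens s :=
  Opens.ext (H.nonvanishing_eq s)

/-- On an affine chart `U_i`, the non-vanishing locus of a section `s` is the basic open of the regular
function `f_i s ∈ Γ(U_i, 𝒪_X)`; hence **`X_s` is quasi-compact when the divisor has finitely many affine
charts** (Görtz–Wedhorn I, (7.11)/Remark 13.46: on a trivialising affine chart `X_s ∩ U_i = D(f_i s)` is a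
principal open, hence quasi-compact). [cite: GortzWedhorn2020, Remark 13.46 (p. 391) with Section (7.11)] -/
theorem isCompact_nonvanishing [Finite D.ι] (haff : ∀ i, IsAffineOpen (D.U i)) {s : X.functionField}
    (hs : D.IsSection s) : IsCompact (D.nonvanishing s) := by
  classical
  -- on each chart, a section `σ i ∈ Γ(U i, 𝒪)` with rational function `f i * s`
  have hσ : ∀ i, (D.U i : Set X).Nonempty →
      ∃ σ : Γ(X, D.U i), ∀ (x : X) (hx : x ∈ D.U i),
        ofSection (genericPoint_mem_of_mem hx) σ = D.f i * s := fun i hne => by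
    obtain ⟨σ, hσ⟩ := exists_germ_eq_of_forall_isRegularAt (genericPoint_mem_of_mem hne.some_mem)
      (fun y hy => hs i y hy)
    exact ⟨σ, fun x hx => hσ⟩
  have hpiece : ∀ i, IsCompact ((D.U i : Set X) ∩ D.nonvanishing s) := fun i => by
    rcases (D.U i : Set X).eq_empty_or_nonempty with he | hne
    · rw [he, Set.empty_inter]; exact isCompact_empty
    obtain ⟨σ, hσ⟩ := hσ i hne
    have heq : (D.U i : Set X) ∩ D.nonvanishing s = (X.basicOpen σ : Set X) := by
      ext x
      refine ⟨fun ⟨hx, hn⟩ => ?_, fun hx => ?_⟩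
      · rw [D.mem_nonvanishing_iff hx, ← hσ x hx] at hn
        exact (isUnitAt_ofSection_iff hx σ).1 hn
      · have hxU : x ∈ D.U i := X.basicOpen_le σ hx
        refine ⟨hxU, ?_⟩
        rw [D.mem_nonvanishing_iff hxU, ← hσ x hxU]
        exact (isUnitAt_ofSection_iff hxU σ).2 hx
    rw [heq]
    exact ((haff i).basicOpen σ).isCompact
  have hcov : D.nonvanishing s = ⋃ i, (D.U i : Set X) ∩ D.nonvanishing s := by
    ext x
    simp only [Set.mem_iUnion, Set.mem_inter_iff]
    exact ⟨fun h => (D.covers x).imp fun i hi => ⟨hi, h⟩, fun ⟨i, _, h⟩ => h⟩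
  rw [hcov]
  exact isCompact_iUnion hpiece

end CartierDivisor

/-! ### Base changes `P ×_K Spec A → P` are surjective -/

/-- `Spec A → Spec K` is surjective for a field `K` and a nontrivial `K`-algebra `A`. [folklore] -/
private theorem surjective_specMap_algebraMap_of_field (K : Type u) [Field K] (A : Type u) [CommRing A]
    [Nontrivial A] [Algebra K A] :
    Surjective (Spec.map (CommRingCat.ofHom (algebraMap K A))) := by
  refine ⟨fun x => ?_⟩
  obtain ⟨y⟩ := (inferInstance : Nonempty (PrimeSpectrum A))
  exact ⟨y, Subsingleton.elim _ _⟩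


/-! ### The projections `P ×_K Spec K[t] → P` and `P ×_K Spec B → P` -/

namespace AmpleSpread

variable {K : Type u} [Field K] {B : Type u} [CommRing B] [Algebra K B]
  {s₁ : Finset B} (P : SchemeOver K)

/-- `pr_t : P ×_K Spec K[t] → P` is dominant (indeed surjective: a base change of
`Spec K[t] → Spec K`). [folklore] -/
private theorem isDominant_fst_stage [Nontrivial B] (t : (Idx B s₁)ᵒᵖ) :
    IsDominant (X := (prodDiagram K B s₁ P).obj t)
      (pullback.fst P.hom ((baseDiagram K B s₁).obj t).hom) := by
  haveI := surjective_specMap_algebraMap_of_field K (sub K B t.unop.1)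
  haveI : Surjective (X := (prodDiagram K B s₁ P).obj t)
      (pullback.fst P.hom ((baseDiagram K B s₁).obj t).hom) :=
    MorphismProperty.pullback_fst _ _ ‹_›
  infer_instance

/-- `pr_B : P ×_K Spec B → P` is dominant (indeed surjective). [folklore] -/
private theorem isDominant_fst_limit [Nontrivial B] :
    IsDominant (X := (prodCone K B s₁ P).pt) (pullback.fst P.hom (specOver K B).hom) := by
  haveI := surjective_specMap_algebraMap_of_field K B
  haveI : Surjective (X := (prodCone K B s₁ P).pt) (pullback.fst P.hom (specOver K B).hom) :=
    MorphismProperty.pullback_fst _ _ ‹_›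
  infer_instance

/-- `π_t ≫ pr_t = pr_B` (`prodCone_π_app_fst`, with the sources displayed as the cone point and the
stage). [folklore] -/
private theorem leg_fst (t : (Idx B s₁)ᵒᵖ) :
    leg B s₁ P t ≫ pullback.fst P.hom ((baseDiagram K B s₁).obj t).hom =
      pullback.fst P.hom (specOver K B).hom :=
  prodCone_π_app_fst K B s₁ P t

/-- `D(f) ≫ pr_t = pr_{t'}` for a transition map `f : t' → t` (`prodDiagram_map_fst`). [folklore] -/
private theorem map_fst {t t' : (Idx B s₁)ᵒᵖ} (f : t' ⟶ t) :
    (prodDiagram K B s₁ P).map f ≫ pullback.fst P.hom ((baseDiagram K B s₁).obj t).hom =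
      pullback.fst P.hom ((baseDiagram K B s₁).obj t').hom :=
  prodDiagram_map_fst K B s₁ P f

end AmpleSpread

/-! ### Pullback bookkeeping (abstract, so that no two stages of a diagram are ever compared) -/

namespace CartierDivisor

variable {X X' : Scheme.{u}} [IsIntegral X] [IsIntegral X'] (D : CartierDivisor X) (g : X' ⟶ X)
  [IsDominant g]

/-- The pullback of a divisor with finitely many charts has finitely many charts. [folklore] -/
private theorem finite_pullback_ι [Finite D.ι] : Finite (D.pullback g).ι := ‹Finite D.ι›

/-- The charts of the pullback along an affine morphism of a divisor with affine charts are affine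
(Mathlib `IsAffineOpen.preimage`). [folklore] -/
private theorem isAffineOpen_pullback_U [IsAffineHom g] (h : ∀ i, IsAffineOpen (D.U i)) :
    ∀ i, IsAffineOpen ((D.pullback g).U i) := fun i => (h i).preimage g

variable {D} in
/-- Sections of `𝒪(g^* D)`, spelt out on the charts `g⁻¹ U_i` with the equations `g^♯ f_i`. [folklore] -/
private theorem isSection_pullback_iff {s : X'.functionField} :
    (D.pullback g).IsSection s ↔
      ∀ i (x' : X'), x' ∈ g ⁻¹ᵁ D.U i → IsRegularAt x' (functionFieldMap g (D.f i) * s) :=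
  Iff.rfl

end CartierDivisor

/-! ### Ampleness descends from the limit `P ×_K Spec B` to a finite stage `P ×_K Spec K[t]` -/

namespace AmpleSpread

variable {K : Type u} [Field K] {B : Type u} [CommRing B] [IsDomain B] [Algebra K B]
  {s₁ : Finset B} {P : SchemeOver K} [QuasiCompact P.hom] [QuasiSeparated P.hom]
  [GeometricallyIntegral P.hom] [IsIntegral (prodCone K B s₁ P).pt]

/-- **Core of the spreading out** (for a divisor `E` on a stage with finitely many non-empty affine
charts): if every point of the limit `P ×_K Spec B` lies in an affine non-vanishing locus `X_s` of a
section `s` of `π_{t₀}^* E`, then on some finer stage `t → t₀` every point lies in an affine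
non-vanishing locus of a section of the pullback of `E`.  Finitely many `X_{s_l}` cover the quasi-compact
limit; the `s_l` descend (`SubalgApprox.exists_functionFieldMap_eq`), their section property descends
chart by chart (`Limits.exists_forall_isRegularAt_functionFieldMap`), the affine cover `X_{s_l}` is the
preimage of an affine open cover `V_l` of a stage (Mathlib `Scheme.exists_isOpenCover_and_isAffine_of_finite`),
and the non-vanishing loci of the descended sections become the preimages of the `V_l` at a finer stage
(Mathlib `exists_map_preimage_eq_map_preimage`, both being quasi-compact). (Görtz–Wedhorn I, Thm. 10.57;
The Stacks Project, Tags 01Z4, 01Z6.) [cite: GortzWedhorn2020, Thm. 10.57 (p. 264)] -/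
theorem exists_hom_forall_affineLocus_of_finite {t₀ : (Idx B s₁)ᵒᵖ}
    (E : CartierDivisor ((prodDiagram K B s₁ P).obj t₀)) [Finite E.ι]
    (hE : ∀ i, IsAffineOpen (E.U i) ∧ (E.U i : Set ((prodDiagram K B s₁ P).obj t₀)).Nonempty)
    (H : ∀ x : (prodCone K B s₁ P).pt, ∃ s, (E.pullback (leg B s₁ P t₀)).IsSection s ∧
      x ∈ (E.pullback (leg B s₁ P t₀)).nonvanishing s ∧
      IsAffineOpen ((E.pullback (leg B s₁ P t₀)).nonvanishingOpens s)) :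
    ∃ (t : (Idx B s₁)ᵒᵖ) (f : t ⟶ t₀), ∀ y : (prodDiagram K B s₁ P).obj t, ∃ σ,
      (E.pullback ((prodDiagram K B s₁ P).map f)).IsSection σ ∧
        y ∈ (E.pullback ((prodDiagram K B s₁ P).map f)).nonvanishing σ ∧
        IsAffineOpen ((E.pullback ((prodDiagram K B s₁ P).map f)).nonvanishingOpens σ) := by
  classical
  -- bookkeeping along the tower: `(D g)^* (D f)^* E` is the divisor `(D (g ≫ f))^* E`
  have hEE : ∀ {t t' : (Idx B s₁)ᵒᵖ} (g : t' ⟶ t) (f : t ⟶ t₀),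
      ((E.pullback ((prodDiagram K B s₁ P).map f)).pullback
        ((prodDiagram K B s₁ P).map g)).SameDivisor
        (E.pullback ((prodDiagram K B s₁ P).map (g ≫ f))) := fun g f =>
    (E.pullback_pullback_sameDivisor _ _).trans
      (E.pullback_congr_sameDivisor ((prodDiagram K B s₁ P).map_comp g f).symm)
  have hEt : ∀ {t : (Idx B s₁)ᵒᵖ} (f : t ⟶ t₀),
      ((E.pullback ((prodDiagram K B s₁ P).map f)).pullback (leg B s₁ P t)).SameDivisor
        (E.pullback (leg B s₁ P t₀)) := fun f =>
    (E.pullback_pullback_sameDivisor _ _).trans (E.pullback_congr_sameDivisor (leg_map B s₁ P f))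
  -- sections and non-vanishing loci move down the tower and to the limit
  have hT : ∀ {t t' : (Idx B s₁)ᵒᵖ} (g : t' ⟶ t) (f : t ⟶ t₀)
      {h : ((prodDiagram K B s₁ P).obj t).functionField},
      (E.pullback ((prodDiagram K B s₁ P).map f)).IsSection h →
      (E.pullback ((prodDiagram K B s₁ P).map (g ≫ f))).IsSection
        (functionFieldMap ((prodDiagram K B s₁ P).map g) h) := fun g f _ hh =>
    (hEE g f).isSection (hh.pullback _)
  have hN : ∀ {t t' : (Idx B s₁)ᵒᵖ} (g : t' ⟶ t) (f : t ⟶ t₀)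
      {h : ((prodDiagram K B s₁ P).obj t).functionField},
      (E.pullback ((prodDiagram K B s₁ P).map f)).IsSection h →
      (E.pullback ((prodDiagram K B s₁ P).map (g ≫ f))).nonvanishingOpens
          (functionFieldMap ((prodDiagram K B s₁ P).map g) h) =
        (prodDiagram K B s₁ P).map g ⁻¹ᵁ
          (E.pullback ((prodDiagram K B s₁ P).map f)).nonvanishingOpens h := fun g f _ hh => by
    rw [CartierDivisor.preimage_nonvanishingOpens _ hh]
    exact ((hEE g f).nonvanishingOpens_eq _).symm
  have hNleg : ∀ {t : (Idx B s₁)ᵒᵖ} (f : t ⟶ t₀)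
      {h : ((prodDiagram K B s₁ P).obj t).functionField},
      (E.pullback ((prodDiagram K B s₁ P).map f)).IsSection h →
      leg B s₁ P t ⁻¹ᵁ (E.pullback ((prodDiagram K B s₁ P).map f)).nonvanishingOpens h =
        (E.pullback (leg B s₁ P t₀)).nonvanishingOpens (functionFieldMap (leg B s₁ P t) h) :=
    fun f _ hh => by
    rw [CartierDivisor.preimage_nonvanishingOpens _ hh]
    exact (hEt f).nonvanishingOpens_eq _
  -- Step 1: finitely many affine `X_{s_l}` cover the (quasi-compact) limit
  choose s hs hxs haff using H
  obtain ⟨S, hS⟩ := CompactSpace.elim_nhds_subcover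
    (fun x => (E.pullback (leg B s₁ P t₀)).nonvanishing (s x))
    (fun x => ((E.pullback (leg B s₁ P t₀)).isOpen_nonvanishing (s x)).mem_nhds (hxs x))
  have hcov : IsOpenCover fun l : S => (E.pullback (leg B s₁ P t₀)).nonvanishingOpens (s l) :=
    top_le_iff.1 fun x _ => by
      have hx : x ∈ ⋃ y ∈ S, (E.pullback (leg B s₁ P t₀)).nonvanishing (s y) := by
        rw [hS]; exact Set.mem_univ x
      obtain ⟨y, hy, hxy⟩ := Set.mem_iUnion₂.1 hx
      exact Opens.mem_iSup.2 ⟨⟨y, hy⟩, hxy⟩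
  -- Step 2: the rational functions `s_l` descend to a common stage `t₁ → t₀`
  have h2 := fun l : S => SubalgApprox.exists_functionFieldMap_eq (P := P) t₀ (s l)
  choose T₁ f₁ h₁ hh₁ using h2
  obtain ⟨t₁, ht₁⟩ := exists_hom_of_finite B s₁ (Sum.elim T₁ fun _ : Unit => t₀)
  obtain ⟨f₁₀⟩ : Nonempty (t₁ ⟶ t₀) := ht₁ (Sum.inr ())
  let g₁ : ∀ l : S, t₁ ⟶ T₁ l := fun l => (ht₁ (Sum.inl l)).some
  let hst₁ : S → ((prodDiagram K B s₁ P).obj t₁).functionField := fun l =>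
    functionFieldMap ((prodDiagram K B s₁ P).map (g₁ l)) (h₁ l)
  have key₁ : ∀ l, functionFieldMap (leg B s₁ P t₁) (hst₁ l) = s l := fun l => by
    rw [functionFieldMap_leg_map]
    exact hh₁ l
  -- Step 3: the section property descends, chart by chart (finitely many charts and sections)
  have h3 : ∀ p : S × E.ι, ∃ (t' : (Idx B s₁)ᵒᵖ) (f : t' ⟶ t₁),
      ∀ w ∈ (prodDiagram K B s₁ P).map f ⁻¹ᵁ ((prodDiagram K B s₁ P).map f₁₀ ⁻¹ᵁ E.U p.2),
        IsRegularAt w (functionFieldMap ((prodDiagram K B s₁ P).map f)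
          (functionFieldMap ((prodDiagram K B s₁ P).map f₁₀) (E.f p.2) * hst₁ p.1)) := by
    intro p
    refine Limits.exists_forall_isRegularAt_functionFieldMap (prodDiagram K B s₁ P)
      (prodCone K B s₁ P) (isLimitProdCone K B s₁ P)
      ((hE p.2).1.preimage ((prodDiagram K B s₁ P).map f₁₀)).isCompact
      ⟨_, genericPoint_mem_preimage ((prodDiagram K B s₁ P).map f₁₀)
        (genericPoint_mem_of_mem (hE p.2).2.some_mem)⟩ fun w hw => ?_
    rw [map_mul, key₁, functionFieldMap_leg_map]
    have hw' : w ∈ leg B s₁ P t₀ ⁻¹ᵁ E.U p.2 := by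
      rw [← preimage_map_preimage f₁₀]
      exact hw
    exact (CartierDivisor.isSection_pullback_iff _).1 (hs p.1) p.2 w hw'
  choose T₂ f₂ hreg using h3
  obtain ⟨t₂, ht₂⟩ :=
    exists_hom_of_finite B s₁ (Sum.elim (fun p : S × E.ι => T₂ p) fun _ : Unit => t₁)
  obtain ⟨f₂₁⟩ : Nonempty (t₂ ⟶ t₁) := ht₂ (Sum.inr ())
  let g₂ : ∀ p : S × E.ι, t₂ ⟶ T₂ p := fun p => (ht₂ (Sum.inl p)).some
  let hst₂ : S → ((prodDiagram K B s₁ P).obj t₂).functionField := fun l =>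
    functionFieldMap ((prodDiagram K B s₁ P).map f₂₁) (hst₁ l)
  have key₂ : ∀ l, functionFieldMap (leg B s₁ P t₂) (hst₂ l) = s l := fun l => by
    rw [functionFieldMap_leg_map]
    exact key₁ l
  have hsec₂ : ∀ l, (E.pullback ((prodDiagram K B s₁ P).map (f₂₁ ≫ f₁₀))).IsSection (hst₂ l) := by
    intro l
    refine (CartierDivisor.isSection_pullback_iff _).2 fun i w hw => ?_
    -- move to the stage `T₂ (l, i)`, where regularity on the chart `i` was descended
    have e : g₂ (l, i) ≫ f₂ (l, i) = f₂₁ := hom_eq _ _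
    have hw' : (prodDiagram K B s₁ P).map (g₂ (l, i)) w ∈
        (prodDiagram K B s₁ P).map (f₂ (l, i)) ⁻¹ᵁ ((prodDiagram K B s₁ P).map f₁₀ ⁻¹ᵁ E.U i) := by
      rw [← Scheme.Hom.mem_preimage, map_preimage_map_preimage, e, map_preimage_map_preimage]
      exact hw
    have hr := (hreg (l, i) _ hw').functionFieldMap
      (f := (prodDiagram K B s₁ P).map (g₂ (l, i))) (x' := w)
    rw [functionFieldMap_map_map, e, map_mul, functionFieldMap_map_map] at hr
    exact hr
  -- Step 4: the affine cover `X_{s_l}` of the limit is the preimage of an affine open cover `V_l`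
  -- of a stage `tV`
  obtain ⟨tV, V, hV, hVaff⟩ := Scheme.exists_isOpenCover_and_isAffine_of_finite
    (prodDiagram K B s₁ P) (prodCone K B s₁ P) (isLimitProdCone K B s₁ P) _ hcov fun l => haff l
  have hVO : ∀ l, leg B s₁ P tV ⁻¹ᵁ V l = (E.pullback (leg B s₁ P t₀)).nonvanishingOpens (s l) :=
    fun l => (hVaff l).2.symm
  -- Step 5: on a common refinement `t₃` of `t₂` and `tV`, the non-vanishing loci `N_l` of the
  -- descended sections and the `V_l` have the same (affine) preimage `X_{s_l}` in the limit; being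
  -- quasi-compact, they agree at a finer stage
  obtain ⟨t₃, ⟨a⟩, ⟨b⟩⟩ := exists_hom₂ B s₁ t₂ tV
  haveI : Finite (E.pullback ((prodDiagram K B s₁ P).map (f₂₁ ≫ f₁₀))).ι :=
    E.finite_pullback_ι _
  have hNcpt : ∀ l, IsCompact (((prodDiagram K B s₁ P).map a ⁻¹ᵁ
      (E.pullback ((prodDiagram K B s₁ P).map (f₂₁ ≫ f₁₀))).nonvanishingOpens (hst₂ l) :
        ((prodDiagram K B s₁ P).obj t₃).Opens) : Set ((prodDiagram K B s₁ P).obj t₃)) := fun l =>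
    ((prodDiagram K B s₁ P).map a).isCompact_preimage
      (CartierDivisor.isCompact_nonvanishing (E.isAffineOpen_pullback_U _ fun i => (hE i).1)
        (hsec₂ l))
  have hVcpt : ∀ l, IsCompact (((prodDiagram K B s₁ P).map b ⁻¹ᵁ V l :
      ((prodDiagram K B s₁ P).obj t₃).Opens) : Set ((prodDiagram K B s₁ P).obj t₃)) := fun l =>
    ((hVaff l).1.preimage _).isCompact
  have hNV : ∀ l, leg B s₁ P t₃ ⁻¹ᵁ ((prodDiagram K B s₁ P).map a ⁻¹ᵁ
      (E.pullback ((prodDiagram K B s₁ P).map (f₂₁ ≫ f₁₀))).nonvanishingOpens (hst₂ l)) =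
      leg B s₁ P t₃ ⁻¹ᵁ ((prodDiagram K B s₁ P).map b ⁻¹ᵁ V l) := fun l => by
    rw [preimage_map_preimage, preimage_map_preimage, hNleg _ (hsec₂ l), key₂, hVO]
  have h5 := fun l => exists_map_preimage_eq_map_preimage (prodDiagram K B s₁ P)
    (prodCone K B s₁ P) (isLimitProdCone K B s₁ P) (hNcpt l) (hVcpt l) (hNV l)
  choose T₄ f₄ hNV₄ using h5
  obtain ⟨t₅, ht₅⟩ := exists_hom_of_finite B s₁ (Sum.elim T₄ fun _ : Unit => t₃)
  obtain ⟨c⟩ : Nonempty (t₅ ⟶ t₃) := ht₅ (Sum.inr ())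
  let g₅ : ∀ l : S, t₅ ⟶ T₄ l := fun l => (ht₅ (Sum.inl l)).some
  -- Step 6: the stage `t₅`, with the sections `(D (c ≫ a))^♯ h_l`
  refine ⟨t₅, (c ≫ a) ≫ f₂₁ ≫ f₁₀, fun y => ?_⟩
  obtain ⟨l, hl⟩ := hV.exists_mem ((prodDiagram K B s₁ P).map (c ≫ b) y)
  have hopen : (E.pullback ((prodDiagram K B s₁ P).map ((c ≫ a) ≫ f₂₁ ≫ f₁₀))).nonvanishingOpens
      (functionFieldMap ((prodDiagram K B s₁ P).map (c ≫ a)) (hst₂ l)) =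
      (prodDiagram K B s₁ P).map (c ≫ b) ⁻¹ᵁ V l := by
    have e : g₅ l ≫ f₄ l = c := hom_eq _ _
    have h6 : (prodDiagram K B s₁ P).map c ⁻¹ᵁ ((prodDiagram K B s₁ P).map a ⁻¹ᵁ
        (E.pullback ((prodDiagram K B s₁ P).map (f₂₁ ≫ f₁₀))).nonvanishingOpens (hst₂ l)) =
        (prodDiagram K B s₁ P).map c ⁻¹ᵁ ((prodDiagram K B s₁ P).map b ⁻¹ᵁ V l) := by
      rw [← e, ← map_preimage_map_preimage, ← map_preimage_map_preimage, hNV₄ l]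
    rw [hN _ _ (hsec₂ l), ← map_preimage_map_preimage c a, h6, map_preimage_map_preimage]
  refine ⟨functionFieldMap ((prodDiagram K B s₁ P).map (c ≫ a)) (hst₂ l), hT _ _ (hsec₂ l), ?_, ?_⟩
  · rw [← CartierDivisor.mem_nonvanishingOpens, hopen]
    exact hl
  · rw [hopen]
    exact (hVaff l).1.preimage _

omit [QuasiSeparated P.hom] [IsIntegral (prodCone K B s₁ P).pt] in
/-- A Cartier divisor on a stage has the same divisor as one with finitely many non-empty affine
charts (`CartierDivisor.exists_sameDivisor_finite_isAffineOpen` on the quasi-compact stage). [folklore] -/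
private theorem exists_sameDivisor_finite (t₀ : (Idx B s₁)ᵒᵖ)
    (E : CartierDivisor ((prodDiagram K B s₁ P).obj t₀)) :
    ∃ E' : CartierDivisor ((prodDiagram K B s₁ P).obj t₀), E'.SameDivisor E ∧ Finite E'.ι ∧
      ∀ i, IsAffineOpen (E'.U i) ∧ (E'.U i : Set ((prodDiagram K B s₁ P).obj t₀)).Nonempty := by
  obtain ⟨E', hE'E, hfin, hch⟩ := E.exists_sameDivisor_finite_isAffineOpen
  exact ⟨E', hE'E, hfin, fun i => ⟨(hch i).1, (hch i).2.1⟩⟩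

/-- **Spreading out of affine non-vanishing loci**, for an arbitrary Cartier divisor `E` on a stage
`P ×_K Spec K[t₀]`: if every point of the limit lies in an affine `X_s` for a section `s` of
`π_{t₀}^* E`, then the same holds on some finer stage for the pullback of `E`
(`exists_hom_forall_affineLocus_of_finite` after refining the charts of `E`, the data being invariant
under `SameDivisor`). [cite: GortzWedhorn2020, Thm. 10.57 (p. 264)] -/
theorem exists_hom_forall_affineLocus {t₀ : (Idx B s₁)ᵒᵖ}
    (E : CartierDivisor ((prodDiagram K B s₁ P).obj t₀))
    (H : ∀ x : (prodCone K B s₁ P).pt, ∃ s, (E.pullback (leg B s₁ P t₀)).IsSection s ∧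
      x ∈ (E.pullback (leg B s₁ P t₀)).nonvanishing s ∧
      IsAffineOpen ((E.pullback (leg B s₁ P t₀)).nonvanishingOpens s)) :
    ∃ (t : (Idx B s₁)ᵒᵖ) (f : t ⟶ t₀), ∀ y : (prodDiagram K B s₁ P).obj t, ∃ σ,
      (E.pullback ((prodDiagram K B s₁ P).map f)).IsSection σ ∧
        y ∈ (E.pullback ((prodDiagram K B s₁ P).map f)).nonvanishing σ ∧
        IsAffineOpen ((E.pullback ((prodDiagram K B s₁ P).map f)).nonvanishingOpens σ) := by
  obtain ⟨E', hE'E, hfin, hE'⟩ := exists_sameDivisor_finite t₀ E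
  haveI := hfin
  have h0 : (E'.pullback (leg B s₁ P t₀)).SameDivisor (E.pullback (leg B s₁ P t₀)) :=
    hE'E.pullback _
  obtain ⟨t, f, Ht⟩ := exists_hom_forall_affineLocus_of_finite E' hE' fun x => by
    obtain ⟨s, hs, hxs, haff⟩ := H x
    refine ⟨s, h0.symm.isSection hs, ?_, ?_⟩
    · rw [h0.nonvanishing_eq]; exact hxs
    · rw [h0.nonvanishingOpens_eq]; exact haff
  have h1 : (E'.pullback ((prodDiagram K B s₁ P).map f)).SameDivisor
      (E.pullback ((prodDiagram K B s₁ P).map f)) := hE'E.pullback _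
  refine ⟨t, f, fun y => ?_⟩
  obtain ⟨σ, hσ, hy, haff⟩ := Ht y
  refine ⟨σ, h1.isSection hσ, ?_, ?_⟩
  · rw [← h1.nonvanishing_eq]; exact hy
  · rw [← h1.nonvanishingOpens_eq]; exact haff

end AmpleSpread

/-- **Ampleness spreads out from the limit to a finite stage**: for `K` a field, `B` a `K`-algebra which
is a domain, `P → Spec K` quasi-compact, quasi-separated and geometrically integral, and a Cartier
divisor `E` on a stage `P ×_K Spec K[t₀]` whose pullback to `P ×_K Spec B = lim_t P ×_K Spec K[t]` is
AMPLE, the pullback of `E` to some finer stage `P ×_K Spec K[t]` is ample (Görtz–Wedhorn I,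
Prop. 13.47 (iv): ampleness = qcqs + a witness `d ≥ 1` with affine `X_s`, `s ∈ Γ(𝒪(d • E))`, through
every point; the witnessing data spread out by `AmpleSpread.exists_hom_forall_affineLocus` applied to
`d • E`, and the stages are qcqs).
[cite: GortzWedhorn2020, Prop. 13.47 (iv) (p. 392) with Thm. 10.57 (p. 264)] -/
theorem CartierDivisor.IsAmple.exists_hom_isAmple_pullback_map
    {K : Type u} [Field K] {B : Type u} [CommRing B] [IsDomain B] [Algebra K B] {s₁ : Finset B}
    {P : SchemeOver K} [QuasiCompact P.hom] [QuasiSeparated P.hom] [GeometricallyIntegral P.hom]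
    [IsIntegral (prodCone K B s₁ P).pt] {t₀ : (Idx B s₁)ᵒᵖ}
    (E : CartierDivisor ((prodDiagram K B s₁ P).obj t₀))
    (hA : (E.pullback (leg B s₁ P t₀)).IsAmple) :
    ∃ (t : (Idx B s₁)ᵒᵖ) (f : t ⟶ t₀), (E.pullback ((prodDiagram K B s₁ P).map f)).IsAmple := by
  obtain ⟨-, -, d, hd, Hd⟩ := hA
  rw [← CartierDivisor.pullback_smul] at Hd
  obtain ⟨t, f, Ht⟩ := AmpleSpread.exists_hom_forall_affineLocus (d • E) Hd
  rw [CartierDivisor.pullback_smul] at Ht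
  exact ⟨t, f, inferInstance, inferInstance, d, hd, Ht⟩

/-- Ampleness spreads out, cone form for a divisor on `P`: if `D ⊗ B := pr_B^* D` is ample on
`P ×_K Spec B`, then `D ⊗ K[t] := pr_t^* D` is ample on `P ×_K Spec K[t]` for some finitely generated
`K`-subalgebra `K[t] ⊆ B` (`exists_hom_isAmple_pullback_map` for `E := pr_{t₀}^* D`). [folklore] -/
private theorem CartierDivisor.IsAmple.exists_stage_isAmple_fst
    {K : Type u} [Field K] {B : Type u} [CommRing B] [IsDomain B] [Algebra K B] {s₁ : Finset B}
    (P : SchemeOver K) [QuasiCompact P.hom] [QuasiSeparated P.hom] [GeometricallyIntegral P.hom]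
    [IsIntegral P.left] [IsIntegral (prodCone K B s₁ P).pt] (D : CartierDivisor P.left)
    (hA : (haveI := AmpleSpread.isDominant_fst_limit (s₁ := s₁) P;
      D.pullback (X' := (prodCone K B s₁ P).pt) (pullback.fst P.hom (specOver K B).hom)).IsAmple) :
    ∃ t : (Idx B s₁)ᵒᵖ, (haveI := AmpleSpread.isDominant_fst_stage P t;
      D.pullback (X' := (prodDiagram K B s₁ P).obj t)
        (pullback.fst P.hom ((baseDiagram K B s₁).obj t).hom)).IsAmple := by
  haveI := AmpleSpread.isDominant_fst_limit (s₁ := s₁) P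
  haveI := fun t => AmpleSpread.isDominant_fst_stage (s₁ := s₁) P t
  let t₀ : (Idx B s₁)ᵒᵖ := Opposite.op default
  have h0 : ((D.pullback (X' := (prodDiagram K B s₁ P).obj t₀)
      (pullback.fst P.hom ((baseDiagram K B s₁).obj t₀).hom)).pullback (leg B s₁ P t₀)).SameDivisor
      (D.pullback (X' := (prodCone K B s₁ P).pt) (pullback.fst P.hom (specOver K B).hom)) :=
    (D.pullback_pullback_sameDivisor (X' := (prodDiagram K B s₁ P).obj t₀)
        (pullback.fst P.hom ((baseDiagram K B s₁).obj t₀).hom) (leg B s₁ P t₀)).trans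
      (D.pullback_congr_sameDivisor (AmpleSpread.leg_fst P t₀))
  obtain ⟨t, f, ht⟩ := CartierDivisor.IsAmple.exists_hom_isAmple_pullback_map
    (D.pullback (X' := (prodDiagram K B s₁ P).obj t₀)
      (pullback.fst P.hom ((baseDiagram K B s₁).obj t₀).hom)) (h0.symm.linEquiv.isAmple hA)
  exact ⟨t, ((D.pullback_pullback_sameDivisor (X' := (prodDiagram K B s₁ P).obj t₀)
      (pullback.fst P.hom ((baseDiagram K B s₁).obj t₀).hom) ((prodDiagram K B s₁ P).map f)).trans
    (D.pullback_congr_sameDivisor (AmpleSpread.map_fst P f))).linEquiv.isAmple ht⟩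

/-! ### The tower form: every intermediate field containing the finite stage -/

/-- `Spec L → Spec R` is dominant for an injective ring map `R → L` (its kernel, zero, is contained in
the nilradical; Mathlib `PrimeSpectrum.denseRange_comap_iff_ker_le_nilRadical`). [folklore] -/
private theorem isDominant_specMap_of_injective {R L : Type u} [CommRing R] [CommRing L] (φ : R →+* L)
    (hφ : Function.Injective φ) : IsDominant (Spec.map (CommRingCat.ofHom φ)) := by
  refine ⟨(PrimeSpectrum.denseRange_comap_iff_ker_le_nilRadical _).2 ?_⟩
  intro x hx
  have hx0 : x = 0 := (injective_iff_map_eq_zero φ).1 hφ x hx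
  rw [hx0]
  exact zero_mem _

/-- **Ampleness spreads out — tower form in the currency of `CartierDivisor.pullback`**: for a field
extension `Ω/K`, `P → Spec K` quasi-compact, quasi-separated and geometrically integral and a Cartier
divisor `D` on `P` whose base change `D ⊗ Ω` to `P ×_K Spec Ω` is ample, there is a finite `s' ⊆ Ω` such
that `D ⊗ L` is ample on `P ×_K Spec L` for every intermediate extension `K → L → Ω` whose image in `Ω`
contains `s'`: with `s'` a finite stage over which `D ⊗ K[s']` is ample
(`exists_hom_isAmple_pullback_map`), `K[s'] ⊆ Ω` lands in `L`,
`P ×_K Spec L → P ×_K Spec K[s']` is affine and dominant, and ampleness pulls back along affine dominant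
morphisms (`CartierDivisor.IsAmple.pullback`, Görtz–Wedhorn I, Prop. 13.66 (2)).
[cite: GortzWedhorn2020, Prop. 13.47 (iv) (p. 392), Thm. 10.57 (p. 264) and Prop. 13.66 (2) (p. 402)] -/
theorem CartierDivisor.IsAmple.exists_finset_forall_isAmple_pullback
    {K Ω : Type u} [Field K] [Field Ω] [Algebra K Ω] (P : SchemeOver K) [QuasiCompact P.hom]
    [QuasiSeparated P.hom] [GeometricallyIntegral P.hom] [IsIntegral P.left] (D : CartierDivisor P.left)
    (hΩ : (D.pullback (pullback.fst P.hom (Spec.map (CommRingCat.ofHom (algebraMap K Ω))))).IsAmple) :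
    ∃ s' : Finset Ω, ∀ (L : Type u) [Field L] [Algebra K L] [Algebra L Ω] [IsScalarTower K L Ω],
      (↑s' : Set Ω) ⊆ Set.range (algebraMap L Ω) →
        (D.pullback (pullback.fst P.hom (Spec.map (CommRingCat.ofHom (algebraMap K L))))).IsAmple := by
  haveI : IsIntegral (prodCone K Ω (∅ : Finset Ω) P).pt := inferInstanceAs
    (IsIntegral ↑(Limits.pullback P.hom (Spec.map (CommRingCat.ofHom (algebraMap K Ω)))))
  obtain ⟨t, ht⟩ :=
    CartierDivisor.IsAmple.exists_stage_isAmple_fst (B := Ω) (s₁ := ∅) P D hΩ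
  refine ⟨t.unop.1, fun L _ _ _ _ hs => ?_⟩
  haveI := AmpleSpread.isDominant_fst_stage (s₁ := (∅ : Finset Ω)) P t
  -- `K[t] ⊆ Ω` lands in (the image of) `L`
  have hinj : Function.Injective (IsScalarTower.toAlgHom K L Ω) := (algebraMap L Ω).injective
  have hle : sub K Ω t.unop.1 ≤ (IsScalarTower.toAlgHom K L Ω).range :=
    Algebra.adjoin_le fun x hx => by
      obtain ⟨y, hy⟩ := hs hx
      exact (AlgHom.mem_range _).2 ⟨y, hy⟩
  let φ : sub K Ω t.unop.1 →ₐ[K] L :=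
    ((AlgEquiv.ofInjective (IsScalarTower.toAlgHom K L Ω) hinj).symm : _ →ₐ[K] L).comp
      (Subalgebra.inclusion hle)
  have hφ : Function.Injective φ :=
    (AlgEquiv.ofInjective (IsScalarTower.toAlgHom K L Ω) hinj).symm.injective.comp
      (Subalgebra.inclusion_injective hle)
  -- the induced morphism of `K`-schemes `Spec L → Spec K[t]` and its base change to `P`
  let g : specOver K L ⟶ (baseDiagram K Ω (∅ : Finset Ω)).obj t :=
    Over.homMk (Spec.map (CommRingCat.ofHom φ.toRingHom)) (by
      change Spec.map _ ≫ Spec.map (CommRingCat.ofHom (algebraMap K (sub K Ω t.unop.1))) =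
        Spec.map (CommRingCat.ofHom (algebraMap K L))
      rw [← Spec.map_comp, ← CommRingCat.ofHom_comp, φ.toRingHom_eq_coe, φ.comp_algebraMap])
  haveI : IsDominant g.left := isDominant_specMap_of_injective φ.toRingHom hφ
  haveI : IsAffineHom g.left := inferInstanceAs (IsAffineHom (Spec.map _))
  haveI : IsIntegral (P ⊗ specOver K L).left := inferInstanceAs
    (IsIntegral ↑(Limits.pullback P.hom (Spec.map (CommRingCat.ofHom (algebraMap K L)))))
  haveI : IsIntegral (P ⊗ (baseDiagram K Ω (∅ : Finset Ω)).obj t).left :=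
    inferInstanceAs (IsIntegral ((prodDiagram K Ω (∅ : Finset Ω) P).obj t))
  let q : (P ⊗ specOver K L).left ⟶ (prodDiagram K Ω (∅ : Finset Ω) P).obj t := (P ◁ g).left
  haveI : IsDominant q := inferInstanceAs (IsDominant (P ◁ g).left)
  haveI : IsAffineHom q := inferInstanceAs (IsAffineHom (P ◁ g).left)
  have hq : q ≫ pullback.fst P.hom ((baseDiagram K Ω (∅ : Finset Ω)).obj t).hom =
      pullback.fst P.hom (specOver K L).hom :=
    Over.whiskerLeft_left_fst g
  haveI : IsDominant (X := (P ⊗ specOver K L).left) (pullback.fst P.hom (specOver K L).hom) :=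
    inferInstanceAs
      (IsDominant (pullback.fst P.hom (Spec.map (CommRingCat.ofHom (algebraMap K L)))))
  exact ((D.pullback_pullback_sameDivisor (X' := (prodDiagram K Ω (∅ : Finset Ω) P).obj t)
      (pullback.fst P.hom ((baseDiagram K Ω (∅ : Finset Ω)).obj t).hom) q).trans
    (D.pullback_congr_sameDivisor hq)).linEquiv.isAmple (ht.pullback q)

/-- **Ampleness spreads out — tower form in the currency of divisor CLASSES** (the (L3) socket: the
descent theorem `AbelianVariety.exists_finset_intermediateField_descent_end_divisor` delivers the
divisor of the model through `CartierDivisor.classPullback`, which for the dominant projections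
`P ×_K Spec L → P` is the class of `CartierDivisor.pullback`, `classPullback_linEquiv_pullback`, and
ampleness is a class invariant, `LinEquiv.isAmple`).
[cite: GortzWedhorn2020, Prop. 13.47 (iv) (p. 392), Thm. 10.57 (p. 264) and Prop. 13.66 (2) (p. 402)] -/
theorem CartierDivisor.IsAmple.exists_finset_forall_isAmple_classPullback
    {K Ω : Type u} [Field K] [Field Ω] [Algebra K Ω] (P : SchemeOver K) [QuasiCompact P.hom]
    [QuasiSeparated P.hom] [GeometricallyIntegral P.hom] [IsIntegral P.left] (D : CartierDivisor P.left)
    (hΩ : (D.classPullback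
      (pullback.fst P.hom (Spec.map (CommRingCat.ofHom (algebraMap K Ω))))).IsAmple) :
    ∃ s' : Finset Ω, ∀ (L : Type u) [Field L] [Algebra K L] [Algebra L Ω] [IsScalarTower K L Ω],
      (↑s' : Set Ω) ⊆ Set.range (algebraMap L Ω) →
        (D.classPullback
          (pullback.fst P.hom (Spec.map (CommRingCat.ofHom (algebraMap K L))))).IsAmple := by
  obtain ⟨s', hs'⟩ := CartierDivisor.IsAmple.exists_finset_forall_isAmple_pullback P D
    ((D.classPullback_linEquiv_pullback _).isAmple hΩ)
  exact ⟨s', fun L _ _ _ _ hs =>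
    (D.classPullback_linEquiv_pullback _).symm.isAmple (hs' L hs)⟩

end Literature.AlgebraicGeometry.Motives

end
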